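import Summits.NavierStokesRegularity.OSWSelfSimilar.SheetREvansEven
import Summits.NavierStokesRegularity.OSWSelfSimilar.SheetRSpectrumEvenPointAssemblyA
import HarnessLib

/-!
# SHEET-ℝ frame, Z3-SR-SPEC EVEN half S2⁺ — KERNEL ASSEMBLY on the even zero-mass class: «the only eigenvalue of `T⁺* + θ⟪h⁺, ·⟫h⁺` with
# `Re σ ≥ −3/100` is `σ = 1/2`, and it is simple», from the NAMED hypotheses of `eq_half_of_pointDataE` instantiated with `J := resolventEven`

HONEST FRAMING (cell ns-blowup GROUP B / zone Z3, case Z3-SR-SPEC EVEN half; HYPOTHESIS-LEDGER v2.1 rows #10⁺ (S1⁺ datum), #11⁺ (`PointDataE`),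
#12⁺ (`MixedFarDatum`), PO⁺ (translation gauge mode at `σ = 1/2`) and (P5)⁺ (identification — hitherto PAPER «no even resolvent dictionary»);
1-D MODEL certificate frame (viscous gCLM/OSW sheet on the line at `(a, c_l, ε) = (1/5, 1/2, 1)`); computer-assisted; not Euler/NS; «violates:
none — MODEL»).  NOTHING here is interval arithmetic and NOTHING here asserts that the hypotheses hold for the sheet.  Given them, the conclusion is
KERNEL: cert-2 g10's abstract `SheetRSpectrumEvenPointAssembly.eq_half_of_pointDataE` is INSTANTIATED with `X := WcevenZ hL` (even zero-mass class of
`L²_w(ℂ)`, a Hilbert space), `J := resolventEven hL K h` (selfsim g14: injective pseudo-resolvent on `{Re σ > −m}` with `‖J(w)g‖ ≤ ‖g‖/(m + Re w)`),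
`E := evansEven hL K h ⟪h⁺,·⟫ h⁺ θ` (the Evans function at the centre datum `h`) and `E₁ := evansEven hL K* h* ⟪h⁺,·⟫ h⁺ θ` (at the perturbed datum
`h*`, for `Ω*`; `‖E₁ − E‖ ≤ pert` on `Re ≥ −3/100` is the (P8⁺) allowance), and (P2)⁺/(P3)⁺ of `SheetREvansEven` translate zeros of `E₁` into
eigenvalues of Kato's closed operator `T⁺* = generatorEven hL K* h*` perturbed by the rank-one `θ⟪h⁺,·⟫h⁺` — in the cell's dictionary
`T⁺* + θ⟪h⁺,·⟫h⁺ = −DG⁺(Ω*)|_{E⁺₀}`: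

* **`eigen_iff_eq_half`** — for every `σ` with `Re σ ≥ −3/100`: a non-zero `u ∈ D(T⁺*)` with `T⁺*u = σu − θ⟪h⁺,u⟫h⁺` exists iff `σ = 1/2`;
* **`eigen_half_simple`** — at `σ = 1/2` the eigenline is spanned by `R⁺*(1/2)h⁺ ≠ 0` and no generalized eigenvector exists.
* **`eigen_iff_eq_halfA`**, **`eigen_half_simpleA`**, **`eigen_set_eq_singletonA`** — the same three from implementation 1's point balls `PointDataEA`
  (cert-2 g10 `SheetRSpectrumEvenPointAssemblyA.eq_half_of_pointDataEA`) in place of implementation 2's `PointDataE`;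
* the COUNT ⇒ SPECTRUM layer (`eigen_iff_eq_half_of_count`, `eigen_set_eq_singleton_of_count`; section `Count`) is stated for ANY proof of
  «every zero of `E⁺*` in `Re ≥ −3/100` is `1/2`», so a third point record plugs in by one line.
So the even S2⁺ word «σ_p(−DG⁺(Ω*)|E⁺₀) ∩ {Re σ ≥ −3/100} = {1/2}, simple» is a KERNEL THEOREM modulo exactly: the two (S1⁺) data, `PointDataE` (or `PointDataEA`),
`MixedFarDatum`, the conjugation symmetry of `E`, the allowance `pert ≤ 1107/200000`, and ONE eigenvector at `1/2` (PO-2 ∧ PO-3).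
The instance argument `[CompleteSpace (WcevenZ hL)]` is supplied by `SheetREvenClass.completeSpace_WcevenZ hL` (`haveI`).
Pure composition; no definition, no named fact, no number of record moves.  WHAT THIS IS NOT: not NS; not a proof that the hypotheses hold.
-/

noncomputable section

namespace Summit.NavierStokesRegularity.OSWSelfSimilar
namespace SheetRSpectrumEvenAssembly

open _root_.MeasureTheory _root_.Set _root_.Filter _root_.Real SheetREnergySpace SheetREvenTests SheetREvenEnergySpace SheetREvenForms
  SheetREvenResolvent SheetREvenResolventIdentity SheetREvenClass SheetRResolventEvenClass SheetREvansEven SheetRComplexPivot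
  SheetRResolventIdentity SheetRSpectrumStepRule SheetRSpectrumEvenWindingLists SheetRSpectrumEvenPointCertificate SheetRSpectrumEvenPointAssembly
  SheetRSpectrumEvenPointCertificateA SheetRSpectrumEvenPointAssemblyA Literature.Analysis.OperatorTheory Complex
open scoped Topology ENNReal ComplexConjugate InnerProductSpace

variable {L D₀ D₁ V₀ c m D₀' D₁' V₀' c' m' : ℝ} {d V d' V' : ℝ → ℝ}

/-- `Re (1/2) = 1/2 > −3/100`. [folklore] -/
theorem ra_lt_half_re : ra < ((1 : ℂ) / 2).re := by
  have : ((1 : ℂ) / 2).re = 1 / 2 := by norm_num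
  rw [this]; norm_num [ra]

section Count

variable (hL : 0 < L) (K' : EspE L hL →L[ℝ] W L) (h' : GardingDataKE L hL d' V' K' D₀' D₁' V₀' c' m')

/-- The Evans function of an (S1⁺) datum with `−m' < −3/100` is analytic on a neighbourhood of every point of the closed rectangle `K⁺`
(it is analytic on the open half-plane `Re σ > −m'`, `SheetREvansEven.analyticOnNhd_evansEven`, which contains the rectangle). [folklore] -/
theorem analyticOnNhd_evansEven_rectE (hm' : -m' < ra) (ℓ : WcevenZ hL →L[ℂ] ℂ) (f : WcevenZ hL) (θ : ℂ) :
    AnalyticOnNhd ℂ (evansEven hL K' h' ℓ f θ) (Icc ra rb ×ℂ Icc rc rd) :=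
  (analyticOnNhd_evansEven hL K' h' ℓ f θ).mono fun _ hz => lt_of_lt_of_le hm' (Complex.mem_reProdIm.1 hz).1.1

/-- (P2)⁺ at the gauge point: a non-zero eigenvector of `T⁺* + θ⟪h⁺,·⟫h⁺` at `σ = 1/2` (PO-2 ∧ PO-3: the translation mode) forces `E⁺*(1/2) = 0`.
[folklore] -/
theorem evansEven_half_eq_zero (hm' : -m' < ra) (hv : WcevenZ hL) (θ : ℂ) {v : WcevenZ hL} (hv0 : v ≠ 0)
    (hv1 : ∃ hu : v ∈ (generatorEven hL K' h' ((1 : ℂ) / 2) (lt_trans hm' ra_lt_half_re)).domain,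
      generatorEven hL K' h' ((1 : ℂ) / 2) (lt_trans hm' ra_lt_half_re) ⟨v, hu⟩ = ((1 : ℂ) / 2) • v - (θ * innerSL ℂ hv v) • hv) :
    evansEven hL K' h' (innerSL ℂ hv) hv θ ((1 : ℂ) / 2) = 0 :=
  (exists_eigen_iff_evansEven_eq_zero hL K' h' (innerSL ℂ hv) hv θ (lt_trans hm' ra_lt_half_re)).1 ⟨v, hv0, hv1⟩

/-- **COUNT ⇒ SPECTRUM (existence/uniqueness).**  If every zero of `E⁺*` in `{Re σ ≥ −3/100}` is `1/2` (the conclusion of either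
`eq_half_of_pointDataE` or `eq_half_of_pointDataEA`) and the translation mode is an eigenvector at `1/2`, then for every `σ` with `Re σ ≥ −3/100`
a non-zero eigenvector of `T⁺* + θ⟪h⁺,·⟫h⁺` at `σ` exists iff `σ = 1/2` ((P2)⁺ both ways). [folklore] -/
theorem eigen_iff_eq_half_of_count (hm' : -m' < ra) (hv : WcevenZ hL) (θ : ℂ)
    (hz : ∀ z : ℂ, ra ≤ z.re → evansEven hL K' h' (innerSL ℂ hv) hv θ z = 0 → z = (1 : ℂ) / 2)
    {v : WcevenZ hL} (hv0 : v ≠ 0)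
    (hv1 : ∃ hu : v ∈ (generatorEven hL K' h' ((1 : ℂ) / 2) (lt_trans hm' ra_lt_half_re)).domain,
      generatorEven hL K' h' ((1 : ℂ) / 2) (lt_trans hm' ra_lt_half_re) ⟨v, hu⟩ = ((1 : ℂ) / 2) • v - (θ * innerSL ℂ hv v) • hv)
    {σ : ℂ} (hσ : ra ≤ σ.re) :
    (∃ u : WcevenZ hL, u ≠ 0 ∧ ∃ hu : u ∈ (generatorEven hL K' h' σ (lt_of_lt_of_le hm' hσ)).domain,
        generatorEven hL K' h' σ (lt_of_lt_of_le hm' hσ) ⟨u, hu⟩ = σ • u - (θ * innerSL ℂ hv u) • hv) ↔ σ = (1 : ℂ) / 2 := by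
  constructor
  · intro hex
    exact hz σ hσ ((exists_eigen_iff_evansEven_eq_zero hL K' h' (innerSL ℂ hv) hv θ (lt_of_lt_of_le hm' hσ)).1 hex)
  · rintro rfl
    exact ⟨v, hv0, hv1⟩

/-- **COUNT ⇒ SPECTRUM (set form).**  Under the hypotheses of `eigen_iff_eq_half_of_count` the set of `σ` with `Re σ ≥ −3/100` carrying a non-zero
eigenvector of `T⁺* + θ⟪h⁺,·⟫h⁺` is `{1/2}`.  (Simplicity at `1/2` from `analyticOrderAt E⁺* (1/2) = 1` is
`SheetREvansEven.eigen_simple_of_analyticOrderAt_eq_one` verbatim.) [folklore] -/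
theorem eigen_set_eq_singleton_of_count (hm' : -m' < ra) (hv : WcevenZ hL) (θ : ℂ)
    (hz : ∀ z : ℂ, ra ≤ z.re → evansEven hL K' h' (innerSL ℂ hv) hv θ z = 0 → z = (1 : ℂ) / 2)
    {v : WcevenZ hL} (hv0 : v ≠ 0)
    (hv1 : ∃ hu : v ∈ (generatorEven hL K' h' ((1 : ℂ) / 2) (lt_trans hm' ra_lt_half_re)).domain,
      generatorEven hL K' h' ((1 : ℂ) / 2) (lt_trans hm' ra_lt_half_re) ⟨v, hu⟩ = ((1 : ℂ) / 2) • v - (θ * innerSL ℂ hv v) • hv) :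
    {σ : ℂ | ∃ hσ : ra ≤ σ.re, ∃ u : WcevenZ hL, u ≠ 0 ∧ ∃ hu : u ∈ (generatorEven hL K' h' σ (lt_of_lt_of_le hm' hσ)).domain,
        generatorEven hL K' h' σ (lt_of_lt_of_le hm' hσ) ⟨u, hu⟩ = σ • u - (θ * innerSL ℂ hv u) • hv} = {(1 : ℂ) / 2} := by
  ext σ
  simp only [Set.mem_setOf_eq, Set.mem_singleton_iff]
  constructor
  · rintro ⟨hσ, hex⟩
    exact (eigen_iff_eq_half_of_count hL K' h' hm' hv θ hz hv0 hv1 hσ).1 hex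
  · rintro rfl
    exact ⟨ra_lt_half_re.le, v, hv0, hv1⟩

end Count

section Assembly

variable (hL : 0 < L) [CompleteSpace (WcevenZ hL)] (K : EspE L hL →L[ℝ] W L) (h : GardingDataKE L hL d V K D₀ D₁ V₀ c m)
  (K' : EspE L hL →L[ℝ] W L) (h' : GardingDataKE L hL d' V' K' D₀' D₁' V₀' c' m')

omit [CompleteSpace (WcevenZ hL)] in
/-- **The hypotheses of `eq_half_of_pointDataE` that the dictionary DISCHARGES**: with `J := resolventEven`, `J` is a pseudo-resolvent on
`U = {Re > −m} ⊇ {Re ≥ −3/100}` with `‖J(w)g‖ ≤ ‖g‖/(m + Re w)` (`m ≥ 3/20`), and `E = evansEven … ⟪h⁺,·⟫ h⁺ θ` has the shape `1 − θ⟪h⁺, J w h⁺⟫`. [folklore] -/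
theorem dictionary (hm : (3 : ℝ) / 20 ≤ m) (hv : WcevenZ hL) (θ : ℂ) :
    IsPseudoResolvent {σ : ℂ | -m < σ.re} (resolventEven hL K h) ∧
      (∀ w : ℂ, ra ≤ w.re → w ∈ {σ : ℂ | -m < σ.re}) ∧
      (∀ w : ℂ, ra ≤ w.re → ∀ g : WcevenZ hL, ‖resolventEven hL K h w g‖ ≤ ‖g‖ / (m + w.re)) ∧
      ∀ w, evansEven hL K h (innerSL ℂ hv) hv θ w = 1 - θ * ⟪hv, resolventEven hL K h w hv⟫_ℂ := by
  have hmra : -m < ra := by simp only [ra]; linarith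
  obtain ⟨h1, h2, h3⟩ := pseudoResolvent_dataE hL K h hmra
  exact ⟨h1, h2, h3, fun w => by rw [evansEven_apply, innerSL_apply_apply]⟩

/-- **THE EVEN SPECTRAL SENTENCE, existence/uniqueness half.**  For every `σ` with `Re σ ≥ −3/100`: a non-zero `u ∈ D(T⁺*)` with
`T⁺*u = σu − θ⟪h⁺,u⟫h⁺` (an eigenvector of `−DG⁺(Ω*)|E⁺₀` at `σ`) exists iff `σ = 1/2`. [folklore] -/
theorem eigen_iff_eq_half (hm : (3 : ℝ) / 20 ≤ m) (hm' : -m' < ra) (hv : WcevenZ hL) (θ : ℂ) (hθ : ‖θ‖ ≤ 4)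
    (hsym : ∀ w, evansEven hL K h (innerSL ℂ hv) hv θ (conj w) = conj (evansEven hL K h (innerSL ℂ hv) hv θ w))
    {pert : ℝ} (hpert : ∀ w : ℂ, ra ≤ w.re →
      ‖evansEven hL K' h' (innerSL ℂ hv) hv θ w - evansEven hL K h (innerSL ℂ hv) hv θ w‖ ≤ pert) (hpert' : pert ≤ (1107 : ℝ) / 200000)
    (hP : PointDataE (resolventEven hL K h) hv hv θ (evansEven hL K h (innerSL ℂ hv) hv θ))
    (hF : MixedFarDatum (resolventEven hL K h) hv hv 1 ((10075811313 : ℝ) / 10000000000) ((754639259 : ℝ) / 200000000)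
      ((1011518153 : ℝ) / 250000000) ((4049925993 : ℝ) / 1000000000))
    {v : WcevenZ hL} (hv0 : v ≠ 0)
    (hv1 : ∃ hu : v ∈ (generatorEven hL K' h' ((1 : ℂ) / 2) (lt_trans hm' ra_lt_half_re)).domain,
      generatorEven hL K' h' ((1 : ℂ) / 2) (lt_trans hm' ra_lt_half_re) ⟨v, hu⟩ = ((1 : ℂ) / 2) • v - (θ * innerSL ℂ hv v) • hv)
    {σ : ℂ} (hσ : ra ≤ σ.re) :
    (∃ u : WcevenZ hL, u ≠ 0 ∧ ∃ hu : u ∈ (generatorEven hL K' h' σ (lt_of_lt_of_le hm' hσ)).domain,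
        generatorEven hL K' h' σ (lt_of_lt_of_le hm' hσ) ⟨u, hu⟩ = σ • u - (θ * innerSL ℂ hv u) • hv) ↔ σ = (1 : ℂ) / 2 := by
  obtain ⟨hJ, hU, hb, hE⟩ := dictionary hL K h hm hv θ
  exact eigen_iff_eq_half_of_count hL K' h' hm' hv θ (eq_half_of_pointDataE hJ hU hm hb hE hθ hsym hpert hpert' hP hF
    (analyticOnNhd_evansEven_rectE hL K' h' hm' _ hv θ) (evansEven_half_eq_zero hL K' h' hm' hv θ hv0 hv1)).1 hv0 hv1 hσ

/-- **THE EVEN SPECTRAL SENTENCE, simplicity half.**  At `σ = 1/2`: `R⁺*(1/2)h⁺ ≠ 0`, the eigenvectors of `T⁺* + θ⟪h⁺,·⟫h⁺` at `1/2` are exactly its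
multiples, and no generalized eigenvector over a non-zero eigenvector exists (geometrically and algebraically simple). [folklore] -/
theorem eigen_half_simple (hm : (3 : ℝ) / 20 ≤ m) (hm' : -m' < ra) (hv : WcevenZ hL) (θ : ℂ) (hθ : ‖θ‖ ≤ 4)
    (hsym : ∀ w, evansEven hL K h (innerSL ℂ hv) hv θ (conj w) = conj (evansEven hL K h (innerSL ℂ hv) hv θ w))
    {pert : ℝ} (hpert : ∀ w : ℂ, ra ≤ w.re →
      ‖evansEven hL K' h' (innerSL ℂ hv) hv θ w - evansEven hL K h (innerSL ℂ hv) hv θ w‖ ≤ pert) (hpert' : pert ≤ (1107 : ℝ) / 200000)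
    (hP : PointDataE (resolventEven hL K h) hv hv θ (evansEven hL K h (innerSL ℂ hv) hv θ))
    (hF : MixedFarDatum (resolventEven hL K h) hv hv 1 ((10075811313 : ℝ) / 10000000000) ((754639259 : ℝ) / 200000000)
      ((1011518153 : ℝ) / 250000000) ((4049925993 : ℝ) / 1000000000))
    {v : WcevenZ hL} (hv0 : v ≠ 0)
    (hv1 : ∃ hu : v ∈ (generatorEven hL K' h' ((1 : ℂ) / 2) (lt_trans hm' ra_lt_half_re)).domain,
      generatorEven hL K' h' ((1 : ℂ) / 2) (lt_trans hm' ra_lt_half_re) ⟨v, hu⟩ = ((1 : ℂ) / 2) • v - (θ * innerSL ℂ hv v) • hv) :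
    resolventEven hL K' h' ((1 : ℂ) / 2) hv ≠ 0 ∧
      (∀ u : WcevenZ hL, (∃ hu : u ∈ (generatorEven hL K' h' ((1 : ℂ) / 2) (lt_trans hm' ra_lt_half_re)).domain,
          generatorEven hL K' h' ((1 : ℂ) / 2) (lt_trans hm' ra_lt_half_re) ⟨u, hu⟩ = ((1 : ℂ) / 2) • u - (θ * innerSL ℂ hv u) • hv) ↔
        ∃ t : ℂ, u = t • resolventEven hL K' h' ((1 : ℂ) / 2) hv) ∧
      ∀ δ₀ : WcevenZ hL, δ₀ ≠ 0 →
        (∃ hu : δ₀ ∈ (generatorEven hL K' h' ((1 : ℂ) / 2) (lt_trans hm' ra_lt_half_re)).domain,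
          generatorEven hL K' h' ((1 : ℂ) / 2) (lt_trans hm' ra_lt_half_re) ⟨δ₀, hu⟩ = ((1 : ℂ) / 2) • δ₀ - (θ * innerSL ℂ hv δ₀) • hv) →
        ¬ ∃ δ₁ : WcevenZ hL, ∃ hu : δ₁ ∈ (generatorEven hL K' h' ((1 : ℂ) / 2) (lt_trans hm' ra_lt_half_re)).domain,
            generatorEven hL K' h' ((1 : ℂ) / 2) (lt_trans hm' ra_lt_half_re) ⟨δ₁, hu⟩ =
              ((1 : ℂ) / 2) • δ₁ - (θ * innerSL ℂ hv δ₁) • hv + δ₀ := by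
  obtain ⟨hJ, hU, hb, hE⟩ := dictionary hL K h hm hv θ
  exact eigen_simple_of_analyticOrderAt_eq_one hL K' h' (innerSL ℂ hv) hv θ (lt_trans hm' ra_lt_half_re)
    (eq_half_of_pointDataE hJ hU hm hb hE hθ hsym hpert hpert' hP hF (analyticOnNhd_evansEven_rectE hL K' h' hm' _ hv θ)
      (evansEven_half_eq_zero hL K' h' hm' hv θ hv0 hv1)).2

/-- **The even PASS word, packaged**: the set of `σ` with `Re σ ≥ −3/100` carrying a non-zero eigenvector of `T⁺* + θ⟪h⁺,·⟫h⁺` is `{1/2}`. [folklore] -/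
theorem eigen_set_eq_singleton (hm : (3 : ℝ) / 20 ≤ m) (hm' : -m' < ra) (hv : WcevenZ hL) (θ : ℂ) (hθ : ‖θ‖ ≤ 4)
    (hsym : ∀ w, evansEven hL K h (innerSL ℂ hv) hv θ (conj w) = conj (evansEven hL K h (innerSL ℂ hv) hv θ w))
    {pert : ℝ} (hpert : ∀ w : ℂ, ra ≤ w.re →
      ‖evansEven hL K' h' (innerSL ℂ hv) hv θ w - evansEven hL K h (innerSL ℂ hv) hv θ w‖ ≤ pert) (hpert' : pert ≤ (1107 : ℝ) / 200000)
    (hP : PointDataE (resolventEven hL K h) hv hv θ (evansEven hL K h (innerSL ℂ hv) hv θ))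
    (hF : MixedFarDatum (resolventEven hL K h) hv hv 1 ((10075811313 : ℝ) / 10000000000) ((754639259 : ℝ) / 200000000)
      ((1011518153 : ℝ) / 250000000) ((4049925993 : ℝ) / 1000000000))
    {v : WcevenZ hL} (hv0 : v ≠ 0)
    (hv1 : ∃ hu : v ∈ (generatorEven hL K' h' ((1 : ℂ) / 2) (lt_trans hm' ra_lt_half_re)).domain,
      generatorEven hL K' h' ((1 : ℂ) / 2) (lt_trans hm' ra_lt_half_re) ⟨v, hu⟩ = ((1 : ℂ) / 2) • v - (θ * innerSL ℂ hv v) • hv) :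
    {σ : ℂ | ∃ hσ : ra ≤ σ.re, ∃ u : WcevenZ hL, u ≠ 0 ∧ ∃ hu : u ∈ (generatorEven hL K' h' σ (lt_of_lt_of_le hm' hσ)).domain,
        generatorEven hL K' h' σ (lt_of_lt_of_le hm' hσ) ⟨u, hu⟩ = σ • u - (θ * innerSL ℂ hv u) • hv} = {(1 : ℂ) / 2} := by
  obtain ⟨hJ, hU, hb, hE⟩ := dictionary hL K h hm hv θ
  exact eigen_set_eq_singleton_of_count hL K' h' hm' hv θ (eq_half_of_pointDataE hJ hU hm hb hE hθ hsym hpert hpert' hP hF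
    (analyticOnNhd_evansEven_rectE hL K' h' hm' _ hv θ) (evansEven_half_eq_zero hL K' h' hm' hv θ hv0 hv1)).1 hv0 hv1

/-- **THE EVEN SPECTRAL SENTENCE from IMPLEMENTATION 1's point balls (`PointDataEA`, cert-2 g10 `eq_half_of_pointDataEA`), existence/uniqueness
half.**  As `eigen_iff_eq_half` with `PointDataEA` in place of `PointDataE`.  For every `σ` with `Re σ ≥ −3/100`: a non-zero `u ∈ D(T⁺*)` with
`T⁺*u = σu − θ⟪h⁺,u⟫h⁺` (an eigenvector of `−DG⁺(Ω*)|E⁺₀` at `σ`) exists iff `σ = 1/2`. [folklore] -/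
theorem eigen_iff_eq_halfA (hm : (3 : ℝ) / 20 ≤ m) (hm' : -m' < ra) (hv : WcevenZ hL) (θ : ℂ) (hθ : ‖θ‖ ≤ 4)
    (hsym : ∀ w, evansEven hL K h (innerSL ℂ hv) hv θ (conj w) = conj (evansEven hL K h (innerSL ℂ hv) hv θ w))
    {pert : ℝ} (hpert : ∀ w : ℂ, ra ≤ w.re →
      ‖evansEven hL K' h' (innerSL ℂ hv) hv θ w - evansEven hL K h (innerSL ℂ hv) hv θ w‖ ≤ pert) (hpert' : pert ≤ (1107 : ℝ) / 200000)
    (hP : PointDataEA (resolventEven hL K h) hv hv θ (evansEven hL K h (innerSL ℂ hv) hv θ))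
    (hF : MixedFarDatum (resolventEven hL K h) hv hv 1 ((10075811313 : ℝ) / 10000000000) ((754639259 : ℝ) / 200000000)
      ((1011518153 : ℝ) / 250000000) ((4049925993 : ℝ) / 1000000000))
    {v : WcevenZ hL} (hv0 : v ≠ 0)
    (hv1 : ∃ hu : v ∈ (generatorEven hL K' h' ((1 : ℂ) / 2) (lt_trans hm' ra_lt_half_re)).domain,
      generatorEven hL K' h' ((1 : ℂ) / 2) (lt_trans hm' ra_lt_half_re) ⟨v, hu⟩ = ((1 : ℂ) / 2) • v - (θ * innerSL ℂ hv v) • hv)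
    {σ : ℂ} (hσ : ra ≤ σ.re) :
    (∃ u : WcevenZ hL, u ≠ 0 ∧ ∃ hu : u ∈ (generatorEven hL K' h' σ (lt_of_lt_of_le hm' hσ)).domain,
        generatorEven hL K' h' σ (lt_of_lt_of_le hm' hσ) ⟨u, hu⟩ = σ • u - (θ * innerSL ℂ hv u) • hv) ↔ σ = (1 : ℂ) / 2 := by
  obtain ⟨hJ, hU, hb, hE⟩ := dictionary hL K h hm hv θ
  exact eigen_iff_eq_half_of_count hL K' h' hm' hv θ (eq_half_of_pointDataEA hJ hU hm hb hE hθ hsym hpert hpert' hP hF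
    (analyticOnNhd_evansEven_rectE hL K' h' hm' _ hv θ) (evansEven_half_eq_zero hL K' h' hm' hv θ hv0 hv1)).1 hv0 hv1 hσ

/-- **THE EVEN SPECTRAL SENTENCE from IMPLEMENTATION 1's point balls, simplicity half.**  As `eigen_half_simple` with `PointDataEA`.  At `σ = 1/2`: `R⁺*(1/2)h⁺ ≠ 0`, the eigenvectors of `T⁺* + θ⟪h⁺,·⟫h⁺` at `1/2` are exactly its
multiples, and no generalized eigenvector over a non-zero eigenvector exists (geometrically and algebraically simple). [folklore] -/
theorem eigen_half_simpleA (hm : (3 : ℝ) / 20 ≤ m) (hm' : -m' < ra) (hv : WcevenZ hL) (θ : ℂ) (hθ : ‖θ‖ ≤ 4)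
    (hsym : ∀ w, evansEven hL K h (innerSL ℂ hv) hv θ (conj w) = conj (evansEven hL K h (innerSL ℂ hv) hv θ w))
    {pert : ℝ} (hpert : ∀ w : ℂ, ra ≤ w.re →
      ‖evansEven hL K' h' (innerSL ℂ hv) hv θ w - evansEven hL K h (innerSL ℂ hv) hv θ w‖ ≤ pert) (hpert' : pert ≤ (1107 : ℝ) / 200000)
    (hP : PointDataEA (resolventEven hL K h) hv hv θ (evansEven hL K h (innerSL ℂ hv) hv θ))
    (hF : MixedFarDatum (resolventEven hL K h) hv hv 1 ((10075811313 : ℝ) / 10000000000) ((754639259 : ℝ) / 200000000)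
      ((1011518153 : ℝ) / 250000000) ((4049925993 : ℝ) / 1000000000))
    {v : WcevenZ hL} (hv0 : v ≠ 0)
    (hv1 : ∃ hu : v ∈ (generatorEven hL K' h' ((1 : ℂ) / 2) (lt_trans hm' ra_lt_half_re)).domain,
      generatorEven hL K' h' ((1 : ℂ) / 2) (lt_trans hm' ra_lt_half_re) ⟨v, hu⟩ = ((1 : ℂ) / 2) • v - (θ * innerSL ℂ hv v) • hv) :
    resolventEven hL K' h' ((1 : ℂ) / 2) hv ≠ 0 ∧
      (∀ u : WcevenZ hL, (∃ hu : u ∈ (generatorEven hL K' h' ((1 : ℂ) / 2) (lt_trans hm' ra_lt_half_re)).domain,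
          generatorEven hL K' h' ((1 : ℂ) / 2) (lt_trans hm' ra_lt_half_re) ⟨u, hu⟩ = ((1 : ℂ) / 2) • u - (θ * innerSL ℂ hv u) • hv) ↔
        ∃ t : ℂ, u = t • resolventEven hL K' h' ((1 : ℂ) / 2) hv) ∧
      ∀ δ₀ : WcevenZ hL, δ₀ ≠ 0 →
        (∃ hu : δ₀ ∈ (generatorEven hL K' h' ((1 : ℂ) / 2) (lt_trans hm' ra_lt_half_re)).domain,
          generatorEven hL K' h' ((1 : ℂ) / 2) (lt_trans hm' ra_lt_half_re) ⟨δ₀, hu⟩ = ((1 : ℂ) / 2) • δ₀ - (θ * innerSL ℂ hv δ₀) • hv) →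
        ¬ ∃ δ₁ : WcevenZ hL, ∃ hu : δ₁ ∈ (generatorEven hL K' h' ((1 : ℂ) / 2) (lt_trans hm' ra_lt_half_re)).domain,
            generatorEven hL K' h' ((1 : ℂ) / 2) (lt_trans hm' ra_lt_half_re) ⟨δ₁, hu⟩ =
              ((1 : ℂ) / 2) • δ₁ - (θ * innerSL ℂ hv δ₁) • hv + δ₀ := by
  obtain ⟨hJ, hU, hb, hE⟩ := dictionary hL K h hm hv θ
  exact eigen_simple_of_analyticOrderAt_eq_one hL K' h' (innerSL ℂ hv) hv θ (lt_trans hm' ra_lt_half_re)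
    (eq_half_of_pointDataEA hJ hU hm hb hE hθ hsym hpert hpert' hP hF (analyticOnNhd_evansEven_rectE hL K' h' hm' _ hv θ)
      (evansEven_half_eq_zero hL K' h' hm' hv θ hv0 hv1)).2

/-- **The even PASS word from IMPLEMENTATION 1's point balls, packaged** (as `eigen_set_eq_singleton` with `PointDataEA`): the set of `σ` with `Re σ ≥ −3/100` carrying a non-zero eigenvector of `T⁺* + θ⟪h⁺,·⟫h⁺` is `{1/2}`. [folklore] -/
theorem eigen_set_eq_singletonA (hm : (3 : ℝ) / 20 ≤ m) (hm' : -m' < ra) (hv : WcevenZ hL) (θ : ℂ) (hθ : ‖θ‖ ≤ 4)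
    (hsym : ∀ w, evansEven hL K h (innerSL ℂ hv) hv θ (conj w) = conj (evansEven hL K h (innerSL ℂ hv) hv θ w))
    {pert : ℝ} (hpert : ∀ w : ℂ, ra ≤ w.re →
      ‖evansEven hL K' h' (innerSL ℂ hv) hv θ w - evansEven hL K h (innerSL ℂ hv) hv θ w‖ ≤ pert) (hpert' : pert ≤ (1107 : ℝ) / 200000)
    (hP : PointDataEA (resolventEven hL K h) hv hv θ (evansEven hL K h (innerSL ℂ hv) hv θ))
    (hF : MixedFarDatum (resolventEven hL K h) hv hv 1 ((10075811313 : ℝ) / 10000000000) ((754639259 : ℝ) / 200000000)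
      ((1011518153 : ℝ) / 250000000) ((4049925993 : ℝ) / 1000000000))
    {v : WcevenZ hL} (hv0 : v ≠ 0)
    (hv1 : ∃ hu : v ∈ (generatorEven hL K' h' ((1 : ℂ) / 2) (lt_trans hm' ra_lt_half_re)).domain,
      generatorEven hL K' h' ((1 : ℂ) / 2) (lt_trans hm' ra_lt_half_re) ⟨v, hu⟩ = ((1 : ℂ) / 2) • v - (θ * innerSL ℂ hv v) • hv) :
    {σ : ℂ | ∃ hσ : ra ≤ σ.re, ∃ u : WcevenZ hL, u ≠ 0 ∧ ∃ hu : u ∈ (generatorEven hL K' h' σ (lt_of_lt_of_le hm' hσ)).domain,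
        generatorEven hL K' h' σ (lt_of_lt_of_le hm' hσ) ⟨u, hu⟩ = σ • u - (θ * innerSL ℂ hv u) • hv} = {(1 : ℂ) / 2} := by
  obtain ⟨hJ, hU, hb, hE⟩ := dictionary hL K h hm hv θ
  exact eigen_set_eq_singleton_of_count hL K' h' hm' hv θ (eq_half_of_pointDataEA hJ hU hm hb hE hθ hsym hpert hpert' hP hF
    (analyticOnNhd_evansEven_rectE hL K' h' hm' _ hv θ) (evansEven_half_eq_zero hL K' h' hm' hv θ hv0 hv1)).1 hv0 hv1

end Assembly

end SheetRSpectrumEvenAssembly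
end Summit.NavierStokesRegularity.OSWSelfSimilar

end
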